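import Literature.Geometry.Lorentzian.ProductMetric
import Literature.Geometry.Riemannian.RoundSphere
import Mathlib.Analysis.Calculus.BumpFunction.Basic
import Mathlib.Analysis.Calculus.BumpFunction.InnerProduct
import HarnessLib

/-!
# Extending a locally defined cylinder metric to a global generalized cylinder on `N × ℝ`

Topic `Literature/Geometry/Riemannian`. A brick of the proof programme of
`Literature.Geometry.Riemannian.BaerHankePscGluing` (Bär–Hanke 2023, §3: the metric of `M`
near its boundary is `dt² + g_t` in normal coordinates, and the boundary estimates manipulate the
family `g_t` on a collar `t ∈ [0, ε)` only). The tree's generalized-cylinder calculus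
(`GeneralizedCylinder*.lean`) is written for a Riemannian metric on the WHOLE product `N × ℝ`
with the cylinder property `G((v,a),(w,b)) = G((v,0),(w,0)) + ab`. This file bridges the two:

* `exists_cylinderMetric_extension` — given a field `s` of bilinear forms on `T(N × ℝ)` which,
  on a slab `N × (c - R, c + R)`, is a `C^∞` section, symmetric, positive definite and has the
  cylinder property, and any Riemannian metric `g_N` on `N`, there is a Riemannian `C^∞` metric
  `G` on `N × ℝ` with the cylinder property EVERYWHERE which coincides with `s` on the closed
  slab `N × [c - r, c + r]` (`0 < r < R`). Construction: `G = χ(t) s + (1 - χ(t)) (g_N ⊕ dt²)`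
  with a smooth bump `χ` (`ContDiffBump`, `= 1` on `[c-r, c+r]`, supported in `(c-R, c+R)`);
  convex combinations of positive definite cylinder forms are positive definite cylinder forms.

Since scalar curvature, the induced metrics `g_t`, `K_t` and `H_t` at `(z, t)` with
`|t - c| ≤ r` only depend on the metric near the slice, the cylinder formulas apply to `s`
through `G`. No definitions, no named facts (D-0026).

## References

* C. Bär, B. Hanke, *Boundary conditions for scalar curvature*, arXiv:2012.09127, §3,
  (7)–(9). [BarHanke2023]
* B. O'Neill, *Semi-Riemannian geometry* (1983), Ch. 3, Lemma 3.5 (product metrics). [ONeill1983]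
-/

noncomputable section

open Bundle Set Function Metric Filter
open scoped Manifold ContDiff Topology RealInnerProductSpace

namespace Literature.Geometry.Riemannian

open Literature.Geometry.Lorentzian
open Literature.Geometry.Lorentzian.PseudoRiemannianMetric

variable {E' : Type*} [NormedAddCommGroup E'] [NormedSpace ℝ E']
  {H' : Type*} [TopologicalSpace H'] {I' : ModelWithCorners ℝ E' H'}
  {N : Type*} [TopologicalSpace N] [ChartedSpace H' N] [IsManifold I' ∞ N]

/-- The product metric `g_N ⊕ dt²` on `N × ℝ` evaluated: `g_N(v₁, w₁) + v₂ w₂`. [folklore] -/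
theorem prod_euclidean_apply (gN : PseudoRiemannianMetric I' ∞ E' (TangentSpace I' : N → Type _))
    (p : N × ℝ) (v w : TangentSpace (I'.prod 𝓘(ℝ, ℝ)) p) :
    (gN.prod (euclideanMetric ℝ)).val p v w = gN.val p.1 v.1 w.1 + v.2 * w.2 := by
  obtain ⟨x, t⟩ := p
  rw [PseudoRiemannianMetric.prod_apply, euclideanMetric_apply]
  exact congrArg (fun ρ : ℝ ↦ gN.val x v.1 w.1 + ρ)
    (show inner ℝ v.2 w.2 = v.2 * w.2 from (mul_comm w.2 v.2 : w.2 * v.2 = v.2 * w.2))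

set_option maxHeartbeats 1600000 in
/-- **Global cylindrical extension of a local cylinder metric.** Let `g_N` be a Riemannian
metric on `N` and `s` a field of bilinear forms on `T(N × ℝ)` which on the open slab
`{|t - c| < R}` is a `C^∞` section, symmetric, positive definite, with the cylinder property
`s((v,a),(w,b)) = s((v,0),(w,0)) + ab`. Then for `0 < r < R` there is a Riemannian `C^∞` metric
`G` on `N × ℝ` with the cylinder property everywhere and `G = s` on the closed slab
`{|t - c| ≤ r}`: `G = χ(t) s + (1 - χ(t))(g_N ⊕ dt²)` for a smooth bump `χ`.
[cite: BarHanke2023, §3, (7)] -/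
theorem exists_cylinderMetric_extension
    (gN : PseudoRiemannianMetric I' ∞ E' (TangentSpace I' : N → Type _)) (hgN : gN.IsRiemannian)
    (s : Π p : N × ℝ, TangentSpace (I'.prod 𝓘(ℝ, ℝ)) p →L[ℝ]
      TangentSpace (I'.prod 𝓘(ℝ, ℝ)) p →L[ℝ] ℝ)
    {c r R : ℝ} (hr : 0 < r) (hrR : r < R)
    (hs : ∀ p : N × ℝ, p.2 ∈ ball c R → ContMDiffAt (I'.prod 𝓘(ℝ, ℝ))
      ((I'.prod 𝓘(ℝ, ℝ)).prod 𝓘(ℝ, (E' × ℝ) →L[ℝ] (E' × ℝ) →L[ℝ] ℝ)) ∞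
      (fun q : N × ℝ ↦ TotalSpace.mk' ((E' × ℝ) →L[ℝ] (E' × ℝ) →L[ℝ] ℝ)
        (E := fun q : N × ℝ ↦ TangentSpace (I'.prod 𝓘(ℝ, ℝ)) q →L[ℝ]
          TangentSpace (I'.prod 𝓘(ℝ, ℝ)) q →L[ℝ] ℝ) q (s q)) p)
    (hsymm : ∀ p : N × ℝ, p.2 ∈ ball c R → ∀ v w, s p v w = s p w v)
    (hpos : ∀ p : N × ℝ, p.2 ∈ ball c R → ∀ v, v ≠ 0 → 0 < s p v v)
    (hscyl : ∀ p : N × ℝ, p.2 ∈ ball c R → ∀ v w : TangentSpace (I'.prod 𝓘(ℝ, ℝ)) p,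
      s p v w = s p ((v.1, 0) : TangentSpace (I'.prod 𝓘(ℝ, ℝ)) p)
        ((w.1, 0) : TangentSpace (I'.prod 𝓘(ℝ, ℝ)) p) + v.2 * w.2) :
    ∃ G : PseudoRiemannianMetric (I'.prod 𝓘(ℝ, ℝ)) ∞ (E' × ℝ)
        (TangentSpace (I'.prod 𝓘(ℝ, ℝ)) : N × ℝ → Type _),
      G.IsRiemannian ∧
      (∀ (p : N × ℝ) (v w : TangentSpace (I'.prod 𝓘(ℝ, ℝ)) p),
        G.val p v w = G.val p ((v.1, 0) : TangentSpace (I'.prod 𝓘(ℝ, ℝ)) p)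
          ((w.1, 0) : TangentSpace (I'.prod 𝓘(ℝ, ℝ)) p) + v.2 * w.2) ∧
      ∀ p : N × ℝ, p.2 ∈ closedBall c r → G.val p = s p := by
  -- the bump `χ`: `= 1` on `[c - r, c + r]`, supported in `(c - R', c + R')`, `R' = (r + R)/2`
  set χ : ContDiffBump c := ⟨r, (r + R) / 2, hr, by linarith⟩ with hχ
  have hχR : ∀ t, t ∉ ball c R → (χ : ℝ → ℝ) t = 0 := fun t ht ↦ by
    refine χ.zero_of_le_dist ?_
    have h : R ≤ dist t c := by simpa [mem_ball] using ht
    show (r + R) / 2 ≤ dist t c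
    linarith
  have hχball : ∀ t, (χ : ℝ → ℝ) t ≠ 0 → t ∈ ball c R := fun t ht ↦ by
    by_contra h
    exact ht (hχR t h)
  set f : N × ℝ → ℝ := fun p ↦ (χ : ℝ → ℝ) p.2 with hf
  have hfs : ContMDiff (I'.prod 𝓘(ℝ, ℝ)) 𝓘(ℝ, ℝ) ∞ f :=
    χ.contDiff.contMDiff.comp contMDiff_snd
  have hf0 : ∀ p, 0 ≤ f p := fun p ↦ χ.nonneg
  have hf1 : ∀ p, f p ≤ 1 := fun p ↦ χ.le_one
  -- the product metric
  set P := gN.prod (euclideanMetric ℝ) with hP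
  have hPapply : ∀ (p : N × ℝ) (v w : TangentSpace (I'.prod 𝓘(ℝ, ℝ)) p),
      P.val p v w = gN.val p.1 v.1 w.1 + v.2 * w.2 := prod_euclidean_apply gN
  have hPpos : ∀ (p : N × ℝ) (v : TangentSpace (I'.prod 𝓘(ℝ, ℝ)) p), v ≠ 0 → 0 < P.val p v v :=
    fun p v hv ↦ IsRiemannian.prod hgN isRiemannian_euclideanMetric p v hv
  -- the glued field
  set val : Π p : N × ℝ, TangentSpace (I'.prod 𝓘(ℝ, ℝ)) p →L[ℝ]
      TangentSpace (I'.prod 𝓘(ℝ, ℝ)) p →L[ℝ] ℝ := fun p ↦ f p • s p + (1 - f p) • P.val p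
    with hval
  have hvapply : ∀ (p : N × ℝ) (v w : TangentSpace (I'.prod 𝓘(ℝ, ℝ)) p),
      val p v w = f p * s p v w + (1 - f p) * P.val p v w := fun p v w ↦ by
    simp only [hval, _root_.add_apply, _root_.smul_apply, smul_eq_mul]
  -- positivity
  have hvpos : ∀ (p : N × ℝ) (v : TangentSpace (I'.prod 𝓘(ℝ, ℝ)) p), v ≠ 0 → 0 < val p v v := by
    intro p v hv
    rw [hvapply]
    by_cases h0 : f p = 0
    · rw [h0, zero_mul, zero_add, sub_zero, one_mul]
      exact hPpos p v hv
    · have hfp : 0 < f p := lt_of_le_of_ne (hf0 p) (Ne.symm h0)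
      have hsp : 0 < s p v v := hpos p (hχball p.2 h0) v hv
      exact add_pos_of_pos_of_nonneg (mul_pos hfp hsp)
        (mul_nonneg (by linarith [hf1 p]) (hPpos p v hv).le)
  -- smoothness
  have hsmooth : ContMDiff (I'.prod 𝓘(ℝ, ℝ))
      ((I'.prod 𝓘(ℝ, ℝ)).prod 𝓘(ℝ, (E' × ℝ) →L[ℝ] (E' × ℝ) →L[ℝ] ℝ)) ∞
      (fun q : N × ℝ ↦ TotalSpace.mk' ((E' × ℝ) →L[ℝ] (E' × ℝ) →L[ℝ] ℝ)
        (E := fun q : N × ℝ ↦ TangentSpace (I'.prod 𝓘(ℝ, ℝ)) q →L[ℝ]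
          TangentSpace (I'.prod 𝓘(ℝ, ℝ)) q →L[ℝ] ℝ) q (val q)) := by
    intro p
    have hP1 : ContMDiffAt (I'.prod 𝓘(ℝ, ℝ))
        ((I'.prod 𝓘(ℝ, ℝ)).prod 𝓘(ℝ, (E' × ℝ) →L[ℝ] (E' × ℝ) →L[ℝ] ℝ)) ∞
        (fun q : N × ℝ ↦ TotalSpace.mk' ((E' × ℝ) →L[ℝ] (E' × ℝ) →L[ℝ] ℝ)
          (E := fun q : N × ℝ ↦ TangentSpace (I'.prod 𝓘(ℝ, ℝ)) q →L[ℝ]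
            TangentSpace (I'.prod 𝓘(ℝ, ℝ)) q →L[ℝ] ℝ) q (((fun q ↦ 1 - f q) • P.val) q)) p :=
      (contMDiffAt_const.sub (hfs p)).smul_section (P.contMDiff p)
    by_cases hp : p.2 ∈ ball c R
    · have h1 : ContMDiffAt (I'.prod 𝓘(ℝ, ℝ))
          ((I'.prod 𝓘(ℝ, ℝ)).prod 𝓘(ℝ, (E' × ℝ) →L[ℝ] (E' × ℝ) →L[ℝ] ℝ)) ∞
          (fun q : N × ℝ ↦ TotalSpace.mk' ((E' × ℝ) →L[ℝ] (E' × ℝ) →L[ℝ] ℝ)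
            (E := fun q : N × ℝ ↦ TangentSpace (I'.prod 𝓘(ℝ, ℝ)) q →L[ℝ]
              TangentSpace (I'.prod 𝓘(ℝ, ℝ)) q →L[ℝ] ℝ) q ((f • s) q)) p :=
        (hfs p).smul_section (hs p hp)
      exact h1.add_section hP1
    · -- near `p` the bump vanishes and `val = P`
      have hev : ∀ᶠ q : N × ℝ in 𝓝 p, f q = 0 := by
        have hnot : p.2 ∉ tsupport (χ : ℝ → ℝ) := by
          rw [χ.tsupport_eq]
          intro h
          have h' : dist p.2 c ≤ (r + R) / 2 := h
          have h'' : R ≤ dist p.2 c := by simpa [mem_ball] using hp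
          linarith
        have hz : (χ : ℝ → ℝ) =ᶠ[𝓝 p.2] 0 := by
          rw [← notMem_tsupport_iff_eventuallyEq]
          exact hnot
        exact (continuousAt_snd.eventually hz).mono fun q hq ↦ hq
      refine (P.contMDiff p).congr_of_eventuallyEq (hev.mono fun q hq ↦ ?_)
      show TotalSpace.mk' ((E' × ℝ) →L[ℝ] (E' × ℝ) →L[ℝ] ℝ)
          (E := fun q : N × ℝ ↦ TangentSpace (I'.prod 𝓘(ℝ, ℝ)) q →L[ℝ]
            TangentSpace (I'.prod 𝓘(ℝ, ℝ)) q →L[ℝ] ℝ) q (val q) =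
        TotalSpace.mk' ((E' × ℝ) →L[ℝ] (E' × ℝ) →L[ℝ] ℝ)
          (E := fun q : N × ℝ ↦ TangentSpace (I'.prod 𝓘(ℝ, ℝ)) q →L[ℝ]
            TangentSpace (I'.prod 𝓘(ℝ, ℝ)) q →L[ℝ] ℝ) q (P.val q)
      congr 1
      refine ContinuousLinearMap.ext fun v ↦ ContinuousLinearMap.ext fun w ↦ ?_
      rw [hvapply, hq]
      ring
  refine ⟨⟨val, ?_, ?_, hsmooth⟩, ?_, ?_, ?_⟩
  · -- symmetry
    intro p v w
    rw [hvapply, hvapply, P.symm p v w]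
    by_cases hp : p.2 ∈ ball c R
    · rw [hsymm p hp v w]
    · rw [show f p = 0 from hχR p.2 hp, zero_mul, zero_mul]
  · -- nondegeneracy
    intro p v hv
    by_contra hne
    exact (hvpos p v hne).ne' (hv v)
  · -- Riemannian
    exact fun p v hv ↦ hvpos p v hv
  · -- cylinder property
    intro p v w
    show val p v w = val p _ _ + v.2 * w.2
    rw [hvapply, hvapply, hPapply, hPapply]
    by_cases hp : p.2 ∈ ball c R
    · rw [hscyl p hp v w]
      ring
    · rw [show f p = 0 from hχR p.2 hp]
      ring
  · -- agreement on the closed slab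
    intro p hp
    have h1 : f p = 1 := χ.one_of_mem_closedBall hp
    show val p = s p
    refine ContinuousLinearMap.ext fun v ↦ ContinuousLinearMap.ext fun w ↦ ?_
    rw [hvapply, h1]
    ring

end Literature.Geometry.Riemannian
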